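import Literature.NumberTheory.Sieve.BombieriAsymptoticSieveRoughCells
import HarnessLib

/-!
# Bombieri's asymptotic sieve on `P_r`: the law for polynomial product weights

Topic `Literature/NumberTheory/Sieve`, family `parity`. Proof file (no named fact, no `Prop`
definition) on the road from the tree's PROVED vector form of Bombieri's Theorem 1
(`Bombieri1976_asymptotic_sieve_vector`, [FriedlanderIwaniecPisa1978] p. 722) to the Theorem of
[BombieriRIMS1977] p. 5 for every `r` (`Bombieri1976_PrDistributionMin`), following
[FriedlanderIwaniecPisa1978] p. 723 Remark 4 ("Bombieri [2] uses Theorem 1 to prove results on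
`∑ a_n g(n)` for a wide class of functions `g(n)` with support on «near primes»") exactly as the
tree's `r = 2` proof (`BombieriAsymptoticSievePrDistributionProofs.lean`), whose free model
(`BombieriVector.ev`, `D`, `Pw`, the parity functional `parityMap`, `phi`, `univ`) is reused.

## Main result

`BombieriPr.productLaw_poly`: for `s ≥ 1` and a polynomial `h(t) = ∑_{2 ≤ a ≤ K} c_a t^a` there is a
real number `J = J(s, h)` such that for EVERY Bombieri sequence `A` with density constant `H`,
`∑_{n ≤ x, n squarefree, ω(n) = s} a_n ∏_{p ∣ n} h(log p/log x) = J · M_s(x) + o(A(x)/log x)`,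
`M_s(x) = (1 + (−1)^s) H A(x)/log x − (−1)^s ∑_{p ≤ x} a_p` (`BombieriRoughCells.mainTerm`).

## The argument

For a tuple `e = (e_1, …, e_s)` of exponents `≥ 2` put `f_e = ∏ P_{e_i − 1}` (`P_j = D^j X₀`, the free
lift of `Λ log^j`), of weight `m = |e|`, with `π(f_e) = (−1)^{m−s} ∏ (e_i−1)! X^m`; the balanced
combination `g_e = f_e − (−1)^{s+1} I_e P_{m−1}`, `I_e = ∏(e_i − 1)!/(m − 1)!`, has `π(g_e) = 0`, so
`univ` (Theorem 1 by linearity) applies: `∑_{n ≤ x} a_n g_e(n) = (1 + (−1)^s) I_e H A (log x)^{m−1} + o`.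
The prime term `∑ a_n Λ(n)(log n)^{m−1} = (log x)^m ∑_{p ≤ x} a_p + o(A (log x)^{m−1})`, whence
`∑_{n ≤ x} a_n f_e(n) = I_e (log x)^m M_s(x) + o(A (log x)^{m−1})` (`tuple_law`). With
`Λ̃ = ∑_a (c_a/(log x)^a) Λ log^{a−1}` one has `Λ̃(p) = h(log p/log x)` and
`Λ̃^{⋆s} = ∑_e κ_e f_e` (`κ_e = ∏ c_{e_i} (log x)^{−e_i}`); on squarefree `n`,
`Λ̃^{⋆s}(n) = s!·[ω(n) = s]·∏_{p∣n} Λ̃(p)` (`pow_apply_squarefree`), and on the other `n ≤ x`,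
`|Λ̃^{⋆s}(n)| ≤ (C/log²x)^s (Λ log)^{⋆s}(n) ≤ C' (log x)^{−2} ∑_{D ∣ n proper prime power} (log D)²`
(`lambdaLog_pow_le`), which sums to `O(A/log²x)` by `BombieriP2.junk_bound`.
Also proved here: the Chebyshev bound `∑_{n ≤ x, n ∈ P_s} a_n ∏_{p∣n}(log p/log x) ≪ A(x)/log x`
(`primeProd_log_le`), from Theorem 1 for the vector `(2, 1, …, 1)`.
-/

noncomputable section

open Filter Asymptotics Finset

namespace Literature.NumberTheory.Sieve

section Algebra

open MvPolynomial ArithmeticFunction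

namespace BombieriVector

/-! ### Products of the `P_w` and their parity balance -/

/-- `f_e = ∏ᵢ P_{eᵢ − 1}`, the free lift of `(Λ log^{e₁−1}) ⋆ ⋯ ⋆ (Λ log^{e_s−1})`. [folklore] -/
def PwProd {s : ℕ} (e : Fin s → ℕ) : MvPolynomial ℕ ℝ := ∏ i, Pw (e i - 1)

/-- `I_e = ∏ (eᵢ − 1)!/(|e| − 1)!` (`= ∫_{Δ_s} ∏ uᵢ^{eᵢ−1} dσ`, not used in this form). [folklore] -/
def tupleWeight {s : ℕ} (e : Fin s → ℕ) : ℝ :=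
  (∏ i, (((e i - 1).factorial : ℕ) : ℝ)) / ((((∑ i, e i) - 1).factorial : ℕ) : ℝ)

/-- The balanced combination `g_e = f_e − (−1)^{s+1} I_e P_{|e|−1}`. [folklore] -/
def PwBal {s : ℕ} (e : Fin s → ℕ) : MvPolynomial ℕ ℝ :=
  PwProd e - C ((-1 : ℝ) ^ (s + 1) * tupleWeight e) * Pw ((∑ i, e i) - 1)

variable {s : ℕ}

/-- `f_e` is weighted homogeneous of weight `|e|` (each `eᵢ ≥ 1`). [folklore] -/
theorem isWeightedHomogeneous_PwProd (e : Fin s → ℕ) (he : ∀ i, 1 ≤ e i) :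
    IsWeightedHomogeneous wt (PwProd e) (∑ i, e i) := by
  have h := IsWeightedHomogeneous.prod (Finset.univ : Finset (Fin s)) (fun i => Pw (e i - 1))
    (fun i => e i - 1 + 1) (w := wt) fun i _ => isWeightedHomogeneous_Pw (e i - 1)
  have hsum : ∑ i, (e i - 1 + 1) = ∑ i, e i := Finset.sum_congr rfl fun i _ => by
    have := he i; omega
  rw [hsum] at h
  exact h

/-- `π(f_e) = (∏ (−1)^{eᵢ−1} (eᵢ−1)!) X^{|e|}` (each `eᵢ ≥ 1`). [folklore] -/
theorem parityMap_PwProd (e : Fin s → ℕ) (he : ∀ i, 1 ≤ e i) :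
    parityMap (PwProd e) =
      Polynomial.C (∏ i, ((-1 : ℝ) ^ (e i - 1) * (((e i - 1).factorial : ℕ) : ℝ))) *
        Polynomial.X ^ (∑ i, e i) := by
  unfold PwProd
  rw [map_prod]
  simp_rw [parityMap_Pw]
  rw [Finset.prod_mul_distrib, Finset.prod_pow_eq_pow_sum, map_prod]
  congr 2
  exact Finset.sum_congr rfl fun i _ => by have := he i; omega

/-- `φ(f_e) = ∏ (eᵢ − 1)!`. [folklore] -/
theorem phi_PwProd (e : Fin s → ℕ) : phi (PwProd e) = ∏ i, (((e i - 1).factorial : ℕ) : ℝ) := by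
  unfold PwProd
  rw [map_prod]
  exact Finset.prod_congr rfl fun i _ => phi_Pw _

/-- The sign of `f_e`: `∏ (−1)^{eᵢ − 1} = (−1)^{|e| − 1} (−1)^{s+1}` (each `eᵢ ≥ 1`, `s ≥ 1`). [folklore] -/
theorem prod_neg_one_pow (hs : 1 ≤ s) (e : Fin s → ℕ) (he : ∀ i, 1 ≤ e i) :
    ∏ i, (-1 : ℝ) ^ (e i - 1) = (-1 : ℝ) ^ ((∑ i, e i) - 1) * (-1) ^ (s + 1) := by
  rw [Finset.prod_pow_eq_pow_sum, ← pow_add]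
  have hle : s ≤ ∑ i, e i := by
    calc s = ∑ _i : Fin s, 1 := by simp
      _ ≤ ∑ i, e i := Finset.sum_le_sum fun i _ => he i
  have hsum : ∑ i, (e i - 1) = (∑ i, e i) - s := by
    have h := Finset.sum_tsub_distrib (s := (Finset.univ : Finset (Fin s))) (f := e) (g := fun _ => 1)
      (fun i _ => he i)
    simpa using h
  rw [hsum, neg_one_pow_eq_pow_mod_two (R := ℝ), neg_one_pow_eq_pow_mod_two (R := ℝ) (n := _ + _)]
  congr 1
  omega

/-- **Parity balance**: `π(g_e) = 0` (each `eᵢ ≥ 1`, `s ≥ 1`). [folklore] -/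
theorem parityMap_PwBal (hs : 1 ≤ s) (e : Fin s → ℕ) (he : ∀ i, 1 ≤ e i) :
    parityMap (PwBal e) = 0 := by
  have hle : 1 ≤ ∑ i, e i := by
    obtain ⟨i⟩ : Nonempty (Fin s) := ⟨⟨0, hs⟩⟩
    exact le_trans (he i) (Finset.single_le_sum (fun j _ => Nat.zero_le (e j)) (Finset.mem_univ i))
  have hm : (∑ i, e i) - 1 + 1 = ∑ i, e i := Nat.sub_add_cancel hle
  unfold PwBal
  rw [map_sub, map_mul, parityMap_PwProd e he, parityMap_Pw, parityMap, MvPolynomial.algHom_C,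
    Polynomial.algebraMap_eq, hm, ← mul_assoc, ← map_mul, ← sub_mul, ← map_sub]
  convert zero_mul (Polynomial.X ^ (∑ i, e i) : Polynomial ℝ) using 2
  convert Polynomial.C_0 (R := ℝ) using 2
  rw [Finset.prod_mul_distrib, prod_neg_one_pow hs e he, tupleWeight]
  have hf : ((((∑ i, e i) - 1).factorial : ℕ) : ℝ) ≠ 0 := by exact_mod_cast Nat.factorial_ne_zero _
  field_simp
  ring

/-- `g_e` is weighted homogeneous of weight `|e|` (each `eᵢ ≥ 1`, `s ≥ 1`). [folklore] -/
theorem isWeightedHomogeneous_PwBal (hs : 1 ≤ s) (e : Fin s → ℕ) (he : ∀ i, 1 ≤ e i) :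
    IsWeightedHomogeneous wt (PwBal e) (∑ i, e i) := by
  have hle : 1 ≤ ∑ i, e i := by
    obtain ⟨i⟩ : Nonempty (Fin s) := ⟨⟨0, hs⟩⟩
    exact le_trans (he i) (Finset.single_le_sum (fun j _ => Nat.zero_le (e j)) (Finset.mem_univ i))
  have h2 : IsWeightedHomogeneous wt (Pw ((∑ i, e i) - 1)) (∑ i, e i) := by
    have h := isWeightedHomogeneous_Pw ((∑ i, e i) - 1)
    rwa [Nat.sub_add_cancel hle] at h
  exact (weightedHomogeneousSubmodule ℝ wt (∑ i, e i)).sub_mem (isWeightedHomogeneous_PwProd e he)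
    (h2.C_mul _)

/-- `φ(g_e) = (1 + (−1)^s) ∏ (eᵢ − 1)!`. [folklore] -/
theorem phi_PwBal (e : Fin s → ℕ) :
    phi (PwBal e) = (1 + (-1 : ℝ) ^ s) * ∏ i, (((e i - 1).factorial : ℕ) : ℝ) := by
  unfold PwBal
  rw [map_sub, phi_C_mul, phi_PwProd, phi_Pw, tupleWeight]
  have hf : ((((∑ i, e i) - 1).factorial : ℕ) : ℝ) ≠ 0 := by exact_mod_cast Nat.factorial_ne_zero _
  field_simp
  ring

/-- `ev(f_e) = ∏ ev(P_{eᵢ−1})` (Dirichlet product). [folklore] -/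
theorem ev_PwProd (e : Fin s → ℕ) : ev (PwProd e) = ∏ i, ev (Pw (e i - 1)) := by
  unfold PwProd
  rw [map_prod]

/-- `ev(g_e)(n) = ev(f_e)(n) − (−1)^{s+1} I_e Λ(n)(log n)^{|e|−1}`. [folklore] -/
theorem ev_PwBal_apply (e : Fin s → ℕ) (n : ℕ) :
    ev (PwBal e) n = ev (PwProd e) n -
      (-1 : ℝ) ^ (s + 1) * tupleWeight e * (Λ n * Real.log n ^ ((∑ i, e i) - 1)) := by
  unfold PwBal
  rw [map_sub, ev_C_mul, sub_eq_add_neg, ArithmeticFunction.add_apply, ArithmeticFunction.neg_apply,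
    ArithmeticFunction.smul_map, ev_Pw_apply, smul_eq_mul]
  ring

/-- **Universality for `g_e`**: `∑_{n ≤ x} a_n g_e(n) = (1 + (−1)^s) I_e H A(x)(log x)^{|e|−1} +
o(A(x)(log x)^{|e|−1})` (each `eᵢ ≥ 1`, `s ≥ 1`). [folklore] -/
theorem univ_PwBal (hV : Bombieri1976_asymptotic_sieve_vector) {A : SieveSequence} {H : ℝ}
    (hA : A.IsBombieriSequence) (hH : A.HasDensityConstant H) (hs : 1 ≤ s) (e : Fin s → ℕ)
    (he : ∀ i, 1 ≤ e i) :
    (fun x : ℝ => ∑ n ∈ Ioc 0 ⌊x⌋₊, ev (PwBal e) n * A.a n -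
        (1 + (-1 : ℝ) ^ s) * tupleWeight e * H * A.size x * Real.log x ^ ((∑ i, e i) - 1)) =o[atTop]
      fun x : ℝ => A.size x * Real.log x ^ ((∑ i, e i) - 1) := by
  have h := univ hV hA hH (isWeightedHomogeneous_PwBal hs e he)
    (fun t ht => accessible_of_parityMap_eq_zero (parityMap_PwBal hs e he) ht)
  rw [phi_PwBal] at h
  refine h.congr' (Eventually.of_forall fun x => ?_) EventuallyEq.rfl
  have hf : ((((∑ i, e i) - 1).factorial : ℕ) : ℝ) ≠ 0 := by exact_mod_cast Nat.factorial_ne_zero _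
  simp only [tupleWeight]
  field_simp

end BombieriVector

end Algebra

section Arithmetic

open ArithmeticFunction
open scoped ArithmeticFunction.omega

namespace BombieriPr

/-! ### Dirichlet products of prime-power-supported functions on squarefree integers -/

/-- A prime-power divisor of a squarefree integer is a prime. [folklore] -/
theorem prime_of_isPrimePow_dvd_squarefree {n d : ℕ} (hn : Squarefree n) (hd : d ∣ n)
    (hpp : IsPrimePow d) : d.Prime := by
  obtain ⟨p, k, hp, hk, rfl⟩ := hpp
  have hp' : p.Prime := Nat.prime_iff.mpr hp
  have hsq : Squarefree (p ^ k) := hn.squarefree_of_dvd hd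
  rcases Nat.lt_or_ge k 2 with hk2 | hk2
  · obtain rfl : k = 1 := by omega
    rwa [pow_one]
  · exfalso
    have h2 : p * p ∣ p ^ k := by
      rw [← sq]
      exact pow_dvd_pow p hk2
    have := hsq p h2
    exact hp'.not_isUnit this

/-- **Convolution with a prime-power-supported function at a squarefree integer**:
`(F ⋆ G)(n) = ∑_{p ∣ n} F(p) G(n/p)`. [folklore] -/
theorem mul_apply_squarefree {F : ArithmeticFunction ℝ} (hF : ∀ n, ¬ IsPrimePow n → F n = 0)
    (G : ArithmeticFunction ℝ) {n : ℕ} (hn : Squarefree n) :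
    (F * G) n = ∑ p ∈ n.primeFactors, F p * G (n / p) := by
  rw [ArithmeticFunction.mul_apply, Nat.sum_divisorsAntidiagonal (fun d e => F d * G e),
    Nat.primeFactors_eq_to_filter_divisors_prime, Finset.sum_filter_of_ne]
  intro d hd hne
  have hdn : d ∣ n := Nat.dvd_of_mem_divisors hd
  by_contra hnp
  have hpp : ¬ IsPrimePow d := fun h => hnp (prime_of_isPrimePow_dvd_squarefree hn hdn h)
  exact hne (by rw [hF d hpp, zero_mul])

/-- **Dirichlet powers of a prime-power-supported function at a squarefree integer**:
`F^{⋆s}(n) = s! · [ω(n) = s] · ∏_{p ∣ n} F(p)`. [folklore] -/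
theorem pow_apply_squarefree {F : ArithmeticFunction ℝ} (hF : ∀ n, ¬ IsPrimePow n → F n = 0) :
    ∀ (s : ℕ) {n : ℕ}, Squarefree n →
      (F ^ s) n = if n.primeFactors.card = s then
        ((s.factorial : ℕ) : ℝ) * ∏ p ∈ n.primeFactors, F p else 0
  | 0, n, hn => by
    rw [pow_zero, ArithmeticFunction.one_apply, Nat.factorial_zero, Nat.cast_one, one_mul]
    by_cases h1 : n = 1
    · subst h1
      simp
    · rw [if_neg h1, if_neg]
      intro h
      rw [Finset.card_eq_zero, Nat.primeFactors_eq_empty] at h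
      rcases h with h | h
      · exact hn.ne_zero h
      · exact h1 h
  | s + 1, n, hn => by
    rw [pow_succ', mul_apply_squarefree hF _ hn]
    have hterm : ∀ p ∈ n.primeFactors, F p * (F ^ s) (n / p) =
        if n.primeFactors.card = s + 1 then
          ((s.factorial : ℕ) : ℝ) * ∏ q ∈ n.primeFactors, F q else 0 := by
      intro p hp
      have hsq : Squarefree (n / p) := hn.squarefree_of_dvd (Nat.div_dvd_of_dvd (Nat.dvd_of_mem_primeFactors hp))
      have hpfdiv : (n / p).primeFactors = n.primeFactors.erase p := by
        have hpp := Nat.prime_of_mem_primeFactors hp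
        have h := Nat.primeFactors_div_gcd hn hpp.ne_zero
        rw [Nat.gcd_eq_right (Nat.dvd_of_mem_primeFactors hp)] at h
        rw [h, hpp.primeFactors, Finset.sdiff_singleton_eq_erase]
      rw [pow_apply_squarefree hF s hsq, hpfdiv, Finset.card_erase_of_mem hp]
      have hcard : 1 ≤ n.primeFactors.card := Finset.card_pos.mpr ⟨p, hp⟩
      by_cases hc : n.primeFactors.card = s + 1
      · rw [if_pos (by omega), if_pos hc, ← Finset.mul_prod_erase _ _ hp]
        ring
      · rw [if_neg (by omega), if_neg hc, mul_zero]
    rw [Finset.sum_congr rfl hterm, Finset.sum_const, nsmul_eq_mul]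
    split_ifs with hc
    · rw [hc, Nat.factorial_succ, Nat.cast_mul]
      push_cast
      ring
    · rw [mul_zero]

/-- **Domination of Dirichlet powers**: if `|F(d)| ≤ G(d)` for all `d ≤ N` then
`|F^{⋆s}(n)| ≤ G^{⋆s}(n)` for all `n ≤ N`. [folklore] -/
theorem abs_pow_apply_le {F G : ArithmeticFunction ℝ} {N : ℕ} (hFG : ∀ d, d ≤ N → |F d| ≤ G d) :
    ∀ (s : ℕ) {n : ℕ}, n ≤ N → |(F ^ s) n| ≤ (G ^ s) n
  | 0, n, _ => by
    rw [pow_zero, pow_zero, ArithmeticFunction.one_apply]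
    split_ifs <;> simp
  | s + 1, n, hn => by
    rw [pow_succ', pow_succ', ArithmeticFunction.mul_apply, ArithmeticFunction.mul_apply]
    refine (Finset.abs_sum_le_sum_abs _ _).trans (Finset.sum_le_sum fun y hy => ?_)
    have h1 : y.1 ≤ N := le_trans (Nat.divisor_le (Nat.fst_mem_divisors_of_mem_antidiagonal hy)) hn
    have h2 : y.2 ≤ N := le_trans (Nat.divisor_le (Nat.snd_mem_divisors_of_mem_antidiagonal hy)) hn
    rw [abs_mul]
    have hG : 0 ≤ G y.1 := (abs_nonneg _).trans (hFG _ h1)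
    exact mul_le_mul (hFG _ h1) (abs_pow_apply_le hFG s h2) (abs_nonneg _) hG

/-! ### The weights `Λ · log` and the junk on non-squarefree integers -/

/-- `Λ · log`. [folklore] -/
def lambdaLog : ArithmeticFunction ℝ := ArithmeticFunction.vonMangoldt.pmul ArithmeticFunction.log

/-- `(Λ · log)(n) = Λ(n) log n`. [folklore] -/
@[simp] theorem lambdaLog_apply (n : ℕ) : lambdaLog n = Λ n * Real.log n := by
  rw [lambdaLog, pmul_apply, log_apply]

/-- `Λ · log` vanishes off the prime powers. [folklore] -/
theorem lambdaLog_eq_zero {n : ℕ} (h : ¬ IsPrimePow n) : lambdaLog n = 0 := by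
  rw [lambdaLog_apply, vonMangoldt_eq_zero_iff.mpr h, zero_mul]

/-- `0 ≤ (Λ · log)(n) ≤ (log n)²`. [folklore] -/
theorem lambdaLog_nonneg (n : ℕ) : 0 ≤ lambdaLog n := by
  rw [lambdaLog_apply]
  exact mul_nonneg vonMangoldt_nonneg (Real.log_natCast_nonneg n)

/-- `(Λ · log)(n) ≤ (log n)²`. [folklore] -/
theorem lambdaLog_le (n : ℕ) : lambdaLog n ≤ Real.log n ^ 2 := by
  rw [lambdaLog_apply, sq]
  exact mul_le_mul_of_nonneg_right vonMangoldt_le_log (Real.log_natCast_nonneg n)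

/-- `(Λ · log)(p) = (log p)²` at a prime. [folklore] -/
theorem lambdaLog_prime {p : ℕ} (hp : p.Prime) : lambdaLog p = Real.log p ^ 2 := by
  rw [lambdaLog_apply, vonMangoldt_apply_prime hp, sq]

/-- `(Λ·log)^{⋆s} ≥ 0`. [folklore] -/
theorem lambdaLog_pow_nonneg : ∀ (s n : ℕ), 0 ≤ (lambdaLog ^ s) n
  | 0, n => by
    rw [pow_zero, ArithmeticFunction.one_apply]
    split_ifs <;> norm_num
  | s + 1, n => by
    rw [pow_succ', ArithmeticFunction.mul_apply]
    exact Finset.sum_nonneg fun y _ => mul_nonneg (lambdaLog_nonneg _) (lambdaLog_pow_nonneg s _)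

/-- `(Λ·log)^{⋆s}(n) ≤ (log n)^{2s}` (`∑_{d ∣ n} Λ(d) = log n`). [folklore] -/
theorem lambdaLog_pow_le_log_pow : ∀ (s n : ℕ), (lambdaLog ^ s) n ≤ Real.log n ^ (2 * s)
  | 0, n => by
    rw [pow_zero, ArithmeticFunction.one_apply, mul_zero, pow_zero]
    split_ifs <;> norm_num
  | s + 1, n => by
    rcases Nat.eq_zero_or_pos n with rfl | hn
    · simp
    rw [pow_succ', ArithmeticFunction.mul_apply,
      Nat.sum_divisorsAntidiagonal (fun d e => lambdaLog d * (lambdaLog ^ s) e)]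
    have hlogn : 0 ≤ Real.log n := Real.log_natCast_nonneg n
    have hterm : ∀ d ∈ n.divisors, lambdaLog d * (lambdaLog ^ s) (n / d) ≤
        Λ d * (Real.log n * Real.log n ^ (2 * s)) := by
      intro d hd
      have hdn : d ≤ n := Nat.divisor_le hd
      have hd0 : 0 < d := Nat.pos_of_mem_divisors hd
      have hlogd : Real.log d ≤ Real.log n := Real.log_le_log (by exact_mod_cast hd0) (by exact_mod_cast hdn)
      have hnd : Real.log ((n / d : ℕ) : ℝ) ≤ Real.log n :=
        Real.log_le_log (by exact_mod_cast Nat.div_pos hdn hd0) (by exact_mod_cast Nat.div_le_self n d)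
      have h0 : 0 ≤ Real.log ((n / d : ℕ) : ℝ) := Real.log_natCast_nonneg _
      rw [lambdaLog_apply, mul_assoc]
      refine mul_le_mul_of_nonneg_left ?_ vonMangoldt_nonneg
      exact mul_le_mul hlogd ((lambdaLog_pow_le_log_pow s _).trans
        (pow_le_pow_left₀ h0 hnd _)) (lambdaLog_pow_nonneg s _) hlogn
    refine (Finset.sum_le_sum hterm).trans ?_
    rw [← Finset.sum_mul, vonMangoldt_sum]
    ring_nf
    rfl

/-- `Q(n) = ∑_{D ∣ n, D a proper prime power} (log D)²`. [folklore] -/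
def ppowLogSq (n : ℕ) : ℝ :=
  ∑ D ∈ n.divisors.filter (fun D => IsPrimePow D ∧ ¬ D.Prime), Real.log D ^ 2

/-- `Q(n) ≥ 0`. [folklore] -/
theorem ppowLogSq_nonneg (n : ℕ) : 0 ≤ ppowLogSq n :=
  Finset.sum_nonneg fun _ _ => sq_nonneg _

/-- `Q(n/d) ≤ Q(n)` hmm, more generally `Q(m) ≤ Q(n)` for `m ∣ n`, `n ≠ 0`. [folklore] -/
theorem ppowLogSq_mono {m n : ℕ} (hmn : m ∣ n) (hn : n ≠ 0) : ppowLogSq m ≤ ppowLogSq n := by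
  refine Finset.sum_le_sum_of_subset_of_nonneg (fun D hD => ?_) fun D _ _ => sq_nonneg _
  simp only [Finset.mem_filter, Nat.mem_divisors] at hD ⊢
  exact ⟨⟨hD.1.1.trans hmn, hn⟩, hD.2⟩

/-- A single proper prime power divisor is bounded by `Q`. [folklore] -/
theorem log_sq_le_ppowLogSq {D n : ℕ} (hD : D ∣ n) (hn : n ≠ 0) (hpp : IsPrimePow D) (hnp : ¬ D.Prime) :
    Real.log D ^ 2 ≤ ppowLogSq n := by
  refine Finset.single_le_sum (f := fun D : ℕ => Real.log D ^ 2) (fun D _ => sq_nonneg _) ?_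
  simp only [Finset.mem_filter, Nat.mem_divisors]
  exact ⟨⟨hD, hn⟩, hpp, hnp⟩

/-- The main symbol `Sq_s(n) = [n squarefree, ω(n) = s] ∏_{p ∣ n} (log p)²`. [folklore] -/
def sqMain (s n : ℕ) : ℝ :=
  if Squarefree n ∧ n.primeFactors.card = s then ∏ p ∈ n.primeFactors, Real.log p ^ 2 else 0

/-- `Sq_s(n) ≥ 0`. [folklore] -/
theorem sqMain_nonneg (s n : ℕ) : 0 ≤ sqMain s n := by
  unfold sqMain
  split_ifs
  · exact Finset.prod_nonneg fun p _ => sq_nonneg _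
  · exact le_rfl

/-- `∏_{p ∣ m} (log p)² ≤ (log m)^{2·#}`. [folklore] -/
theorem prod_log_sq_le (m : ℕ) :
    ∏ p ∈ m.primeFactors, Real.log p ^ 2 ≤ Real.log m ^ (2 * m.primeFactors.card) := by
  rw [pow_mul, ← Finset.prod_const]
  refine Finset.prod_le_prod (fun p _ => sq_nonneg _) fun p hp => ?_
  have hp' := Nat.prime_of_mem_primeFactors hp
  have hm0 : m ≠ 0 := (Nat.mem_primeFactors.mp hp).2.2
  have hle : (p : ℝ) ≤ m := by exact_mod_cast Nat.le_of_dvd (Nat.pos_of_ne_zero hm0) (Nat.dvd_of_mem_primeFactors hp)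
  exact pow_le_pow_left₀ (Real.log_nonneg (by exact_mod_cast hp'.one_lt.le))
    (Real.log_le_log (by exact_mod_cast hp'.pos) hle) 2

/-- `Sq_s(m) ≤ (log m)^{2s}`. [folklore] -/
theorem sqMain_le (s m : ℕ) : sqMain s m ≤ Real.log m ^ (2 * s) := by
  unfold sqMain
  split_ifs with h
  · rw [← h.2]; exact prod_log_sq_le m
  · exact pow_nonneg (Real.log_natCast_nonneg m) _

/-- `∑_{p ∣ n} (log p)² ≤ (log n)²`. [folklore] -/
theorem sum_log_sq_primeFactors_le {n : ℕ} (hn : n ≠ 0) :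
    ∑ p ∈ n.primeFactors, Real.log p ^ 2 ≤ Real.log n ^ 2 := by
  have hnn : ∀ p ∈ n.primeFactors, 0 ≤ Real.log p := fun p hp =>
    Real.log_nonneg (by exact_mod_cast (Nat.prime_of_mem_primeFactors hp).one_lt.le)
  have hS : ∑ p ∈ n.primeFactors, Real.log p ≤ Real.log n := by
    have h0 : ∀ p ∈ n.primeFactors, ((p : ℕ) : ℝ) ≠ 0 := fun p hp => by
      exact_mod_cast (Nat.prime_of_mem_primeFactors hp).ne_zero
    rw [← Real.log_prod h0, ← Nat.cast_prod]
    exact Real.log_le_log (by exact_mod_cast Finset.prod_pos fun p hp => (Nat.prime_of_mem_primeFactors hp).pos)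
      (by exact_mod_cast Nat.le_of_dvd (Nat.pos_of_ne_zero hn) (Nat.prod_primeFactors_dvd n))
  have hS0 : 0 ≤ ∑ p ∈ n.primeFactors, Real.log p := Finset.sum_nonneg hnn
  calc ∑ p ∈ n.primeFactors, Real.log p ^ 2
      ≤ ∑ p ∈ n.primeFactors, Real.log p * ∑ q ∈ n.primeFactors, Real.log q := by
        refine Finset.sum_le_sum fun p hp => ?_
        rw [sq]
        exact mul_le_mul_of_nonneg_left (Finset.single_le_sum hnn hp) (hnn p hp)
    _ = (∑ p ∈ n.primeFactors, Real.log p) ^ 2 := by rw [← Finset.sum_mul, sq]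
    _ ≤ Real.log n ^ 2 := pow_le_pow_left₀ hS0 hS 2

/-- The key step of the junk recursion: for `p ∣ n` prime,
`(log p)² Sq_s(n/p) ≤ Sq_{s+1}(n) + [p² ∣ n] (log p)² (log n)^{2s}`. [folklore] -/
theorem log_sq_mul_sqMain_div_le (s : ℕ) {n p : ℕ} (hn : n ≠ 0) (hp : p ∈ n.primeFactors) :
    Real.log p ^ 2 * sqMain s (n / p) ≤
      sqMain (s + 1) n + if p ^ 2 ∣ n then Real.log p ^ 2 * Real.log n ^ (2 * s) else 0 := by
  have hpp := Nat.prime_of_mem_primeFactors hp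
  have hpn := Nat.dvd_of_mem_primeFactors hp
  have hlp : 0 ≤ Real.log p ^ 2 := sq_nonneg _
  by_cases h2 : p ^ 2 ∣ n
  · rw [if_pos h2]
    have h1 : sqMain s (n / p) ≤ Real.log n ^ (2 * s) :=
      (sqMain_le s _).trans (pow_le_pow_left₀ (Real.log_natCast_nonneg _)
        (Real.log_le_log (by exact_mod_cast Nat.div_pos (Nat.le_of_dvd (Nat.pos_of_ne_zero hn) hpn) hpp.pos)
          (by exact_mod_cast Nat.div_le_self n p)) _)
    have := sqMain_nonneg (s + 1) n
    nlinarith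
  · rw [if_neg h2, add_zero]
    unfold sqMain
    by_cases hq : Squarefree (n / p) ∧ (n / p).primeFactors.card = s
    · -- then `n = p · (n/p)` is squarefree with `s + 1` prime factors
      have hcop : Nat.Coprime p (n / p) := by
        rw [hpp.coprime_iff_not_dvd]
        intro h
        apply h2
        rw [sq]
        have := Nat.mul_dvd_mul_left p h
        rwa [Nat.mul_div_cancel' hpn] at this
      have hnp : n = p * (n / p) := (Nat.mul_div_cancel' hpn).symm
      have hsqn : Squarefree n := by
        rw [hnp, Nat.squarefree_mul_iff]
        exact ⟨hcop, hpp.squarefree, hq.1⟩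
      have hpf : (n / p).primeFactors = n.primeFactors.erase p := by
        have h := Nat.primeFactors_div_gcd hsqn hpp.ne_zero
        rw [Nat.gcd_eq_right hpn] at h
        rw [h, hpp.primeFactors, Finset.sdiff_singleton_eq_erase]
      have hcard : n.primeFactors.card = s + 1 := by
        have h := hq.2
        rw [hpf, Finset.card_erase_of_mem hp] at h
        have h1 : 1 ≤ n.primeFactors.card := Finset.card_pos.mpr ⟨p, hp⟩
        omega
      rw [if_pos hq, if_pos ⟨hsqn, hcard⟩, hpf, Finset.mul_prod_erase _ (fun q : ℕ => Real.log (q : ℝ) ^ 2) hp]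
    · rw [if_neg hq, mul_zero]
      split_ifs
      · exact Finset.prod_nonneg fun q _ => sq_nonneg _
      · exact le_rfl

/-- Summing the key step over `p ∣ n`:
`∑_{p ∣ n} (log p)² Sq_s(n/p) ≤ (s+1) Sq_{s+1}(n) + (log n)^{2s} Q(n)`. [folklore] -/
theorem sum_log_sq_mul_sqMain_div_le (s : ℕ) {n : ℕ} (hn : n ≠ 0) :
    ∑ p ∈ n.primeFactors, Real.log p ^ 2 * sqMain s (n / p) ≤
      ((s : ℝ) + 1) * sqMain (s + 1) n + Real.log n ^ (2 * s) * ppowLogSq n := by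
  have h1 : ∑ p ∈ n.primeFactors, Real.log p ^ 2 * sqMain s (n / p) ≤
      ∑ p ∈ n.primeFactors, (sqMain (s + 1) n +
        if p ^ 2 ∣ n then Real.log p ^ 2 * Real.log n ^ (2 * s) else 0) :=
    Finset.sum_le_sum fun p hp => log_sq_mul_sqMain_div_le s hn hp
  refine h1.trans ?_
  rw [Finset.sum_add_distrib, Finset.sum_const, nsmul_eq_mul]
  refine add_le_add ?_ ?_
  · -- `#pf(n) · Sq_{s+1}(n) = (s+1) Sq_{s+1}(n)`
    unfold sqMain
    split_ifs with h
    · rw [h.2]; push_cast; exact le_rfl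
    · simp
  · -- the squares `p² ∣ n` inject into the proper prime power divisors
    rw [← Finset.sum_filter]
    rw [show ∑ p ∈ n.primeFactors.filter (fun p => p ^ 2 ∣ n), Real.log (p : ℝ) ^ 2 * Real.log (n : ℝ) ^ (2 * s) =
        Real.log (n : ℝ) ^ (2 * s) * ∑ p ∈ n.primeFactors.filter (fun p => p ^ 2 ∣ n), Real.log (p : ℝ) ^ 2 by
      rw [Finset.mul_sum]; exact Finset.sum_congr rfl fun p _ => by ring]
    refine mul_le_mul_of_nonneg_left ?_ (pow_nonneg (Real.log_natCast_nonneg n) _)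
    -- `∑_{p² ∣ n} (log p)² ≤ ∑_{p² ∣ n} (log p²)² ≤ Q(n)`
    have hinj : Set.InjOn (fun p : ℕ => p ^ 2) ↑(n.primeFactors.filter (fun p => p ^ 2 ∣ n)) :=
      fun a _ b _ hab => by simpa using (Nat.pow_left_injective (n := 2) two_ne_zero) hab
    calc ∑ p ∈ n.primeFactors.filter (fun p => p ^ 2 ∣ n), Real.log (p : ℝ) ^ 2
        ≤ ∑ p ∈ n.primeFactors.filter (fun p => p ^ 2 ∣ n), Real.log (((p ^ 2 : ℕ) : ℝ)) ^ 2 := by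
          refine Finset.sum_le_sum fun p hp => ?_
          have hp' := Nat.prime_of_mem_primeFactors (Finset.mem_filter.mp hp).1
          have hl : 0 ≤ Real.log (p : ℝ) := Real.log_nonneg (by exact_mod_cast hp'.one_lt.le)
          push_cast
          rw [Real.log_pow]
          push_cast
          nlinarith
      _ = ∑ D ∈ (n.primeFactors.filter (fun p => p ^ 2 ∣ n)).image (fun p : ℕ => p ^ 2),
            Real.log (D : ℝ) ^ 2 := by
          rw [Finset.sum_image hinj]
      _ ≤ ppowLogSq n := by
          refine Finset.sum_le_sum_of_subset_of_nonneg (fun D hD => ?_) fun _ _ _ => sq_nonneg _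
          simp only [Finset.mem_image, Finset.mem_filter] at hD
          obtain ⟨p, ⟨hp, hp2⟩, rfl⟩ := hD
          have hp' := Nat.prime_of_mem_primeFactors hp
          refine Finset.mem_filter.mpr ⟨Nat.mem_divisors.mpr ⟨hp2, hn⟩, ?_, ?_⟩
          · exact ⟨p, 2, hp'.prime, two_pos, rfl⟩
          · intro h
            have h1 : p ∣ p ^ 2 := dvd_pow_self p two_ne_zero
            rcases (Nat.dvd_prime h).mp h1 with h2 | h2
            · exact hp'.one_lt.ne' h2
            · have h3 : p * 1 = p * p := by rw [mul_one, ← sq]; exact h2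
              exact hp'.one_lt.ne (Nat.eq_of_mul_eq_mul_left hp'.pos h3)

/-- **The junk recursion**: for `s ≥ 1` there is `C_s ≥ 0` with
`(Λ·log)^{⋆s}(n) ≤ s! Sq_s(n) + C_s (log n)^{2s−2} Q(n)` for every `n`. [folklore] -/
theorem lambdaLog_pow_le {s : ℕ} (hs : 1 ≤ s) :
    ∃ C : ℝ, 0 ≤ C ∧ ∀ n : ℕ, (lambdaLog ^ s) n ≤
      ((s.factorial : ℕ) : ℝ) * sqMain s n + C * Real.log n ^ (2 * s - 2) * ppowLogSq n := by
  induction s, hs using Nat.le_induction with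
  | base =>
    refine ⟨1, zero_le_one, fun n => ?_⟩
    rw [pow_one, Nat.factorial_one, Nat.cast_one, one_mul, one_mul, show 2 * 1 - 2 = 0 from rfl,
      pow_zero, one_mul]
    by_cases hpp : IsPrimePow n
    · by_cases hp : n.Prime
      · have : sqMain 1 n = Real.log n ^ 2 := by
          unfold sqMain
          rw [if_pos ⟨hp.squarefree, by rw [hp.primeFactors, Finset.card_singleton]⟩, hp.primeFactors,
            Finset.prod_singleton]
        rw [lambdaLog_prime hp, this]
        linarith [ppowLogSq_nonneg n]
      · have h1 := log_sq_le_ppowLogSq (dvd_refl n) hpp.ne_zero hpp hp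
        linarith [lambdaLog_le n, sqMain_nonneg 1 n]
    · rw [lambdaLog_eq_zero hpp]
      linarith [ppowLogSq_nonneg n, sqMain_nonneg 1 n]
  | succ s hs ih =>
    obtain ⟨C, hC0, hC⟩ := ih
    refine ⟨(s.factorial : ℝ) + C + 1, by positivity, fun n => ?_⟩
    rcases Nat.eq_zero_or_pos n with rfl | hn
    · simp [sqMain, ppowLogSq]
    have hn0 : n ≠ 0 := hn.ne'
    have hlogn : 0 ≤ Real.log n := Real.log_natCast_nonneg n
    have hexp : 2 * (s + 1) - 2 = 2 * s := by omega
    rw [hexp, pow_succ', ArithmeticFunction.mul_apply,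
      Nat.sum_divisorsAntidiagonal (fun d e => lambdaLog d * (lambdaLog ^ s) e)]
    -- termwise bound
    set g₁ : ℕ → ℝ := fun d => if d.Prime then (s.factorial : ℝ) * (Real.log d ^ 2 * sqMain s (n / d)) else 0
    set g₂ : ℕ → ℝ := fun d => if d.Prime then C * Real.log n ^ (2 * s - 2) * ppowLogSq n * Real.log d ^ 2 else 0
    set g₃ : ℕ → ℝ := fun d => if IsPrimePow d ∧ ¬ d.Prime then Real.log n ^ (2 * s) * Real.log d ^ 2 else 0
    have hterm : ∀ d ∈ n.divisors, lambdaLog d * (lambdaLog ^ s) (n / d) ≤ g₁ d + g₂ d + g₃ d := by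
      intro d hd
      have hdn : d ∣ n := Nat.dvd_of_mem_divisors hd
      have hd0 : 0 < d := Nat.pos_of_mem_divisors hd
      have hdle : d ≤ n := Nat.divisor_le hd
      have hnd0 : 0 < n / d := Nat.div_pos hdle hd0
      have hlognd : Real.log ((n / d : ℕ) : ℝ) ≤ Real.log n :=
        Real.log_le_log (by exact_mod_cast hnd0) (by exact_mod_cast Nat.div_le_self n d)
      have hlognd0 : 0 ≤ Real.log ((n / d : ℕ) : ℝ) := Real.log_natCast_nonneg _
      simp only [g₁, g₂, g₃]
      by_cases hpp : IsPrimePow d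
      · by_cases hp : d.Prime
        · rw [if_pos hp, if_pos hp, if_neg (fun h => h.2 hp), add_zero, lambdaLog_prime hp]
          have h1 := hC (n / d)
          have h2 : C * Real.log ((n / d : ℕ) : ℝ) ^ (2 * s - 2) * ppowLogSq (n / d) ≤
              C * Real.log n ^ (2 * s - 2) * ppowLogSq n :=
            mul_le_mul (mul_le_mul_of_nonneg_left (pow_le_pow_left₀ hlognd0 hlognd _) hC0)
              (ppowLogSq_mono (Nat.div_dvd_of_dvd hdn) hn0) (ppowLogSq_nonneg _) (by positivity)
          have h3 : 0 ≤ Real.log (d : ℝ) ^ 2 := sq_nonneg _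
          nlinarith
        · rw [if_neg hp, if_neg hp, if_pos ⟨hpp, hp⟩, zero_add, zero_add]
          have h1 : (lambdaLog ^ s) (n / d) ≤ Real.log n ^ (2 * s) :=
            (lambdaLog_pow_le_log_pow s _).trans (pow_le_pow_left₀ hlognd0 hlognd _)
          calc lambdaLog d * (lambdaLog ^ s) (n / d) ≤ Real.log d ^ 2 * Real.log n ^ (2 * s) :=
                mul_le_mul (lambdaLog_le d) h1 (lambdaLog_pow_nonneg s _) (sq_nonneg _)
            _ = Real.log n ^ (2 * s) * Real.log d ^ 2 := mul_comm _ _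
      · rw [lambdaLog_eq_zero hpp, zero_mul]
        have hp : ¬ d.Prime := fun h => hpp h.isPrimePow
        rw [if_neg hp, if_neg hp, if_neg (fun h => hpp h.1)]
        norm_num
    refine (Finset.sum_le_sum hterm).trans ?_
    rw [Finset.sum_add_distrib, Finset.sum_add_distrib]
    -- evaluate the three sums
    have hS₁ : ∑ d ∈ n.divisors, g₁ d ≤ (s.factorial : ℝ) * (((s : ℝ) + 1) * sqMain (s + 1) n +
        Real.log n ^ (2 * s) * ppowLogSq n) := by
      simp only [g₁]
      rw [← Finset.sum_filter, ← Nat.primeFactors_eq_to_filter_divisors_prime, ← Finset.mul_sum]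
      exact mul_le_mul_of_nonneg_left (sum_log_sq_mul_sqMain_div_le s hn0) (by positivity)
    have hS₂ : ∑ d ∈ n.divisors, g₂ d ≤ C * Real.log n ^ (2 * s) * ppowLogSq n := by
      simp only [g₂]
      rw [← Finset.sum_filter, ← Nat.primeFactors_eq_to_filter_divisors_prime, ← Finset.mul_sum]
      have h1 := sum_log_sq_primeFactors_le hn0
      have hs2 : 2 * s - 2 + 2 = 2 * s := by omega
      calc C * Real.log n ^ (2 * s - 2) * ppowLogSq n * ∑ p ∈ n.primeFactors, Real.log p ^ 2
          ≤ C * Real.log n ^ (2 * s - 2) * ppowLogSq n * Real.log n ^ 2 :=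
            mul_le_mul_of_nonneg_left h1 (by have := ppowLogSq_nonneg n; positivity)
        _ = C * Real.log n ^ (2 * s) * ppowLogSq n := by
            have hpow : Real.log (n : ℝ) ^ (2 * s - 2) * Real.log n ^ 2 = Real.log n ^ (2 * s) := by
              rw [← pow_add, hs2]
            rw [← hpow]; ring
    have hS₃ : ∑ d ∈ n.divisors, g₃ d = Real.log n ^ (2 * s) * ppowLogSq n := by
      simp only [g₃]
      rw [← Finset.sum_filter, ppowLogSq, Finset.mul_sum]
    rw [hS₃, Nat.factorial_succ, Nat.cast_mul]
    push_cast
    have h0 : 0 ≤ Real.log n ^ (2 * s) * ppowLogSq n := mul_nonneg (pow_nonneg hlogn _) (ppowLogSq_nonneg n)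
    have h0' : 0 ≤ sqMain (s + 1) n := sqMain_nonneg _ _
    nlinarith [hS₁, hS₂]

/-- On a NON-squarefree integer the junk recursion reads `(Λ·log)^{⋆s}(n) ≤ C_s (log n)^{2s−2} Q(n)`.
[folklore] -/
theorem lambdaLog_pow_le_of_not_squarefree {s : ℕ} {C : ℝ}
    (hC : ∀ n : ℕ, (lambdaLog ^ s) n ≤
      ((s.factorial : ℕ) : ℝ) * sqMain s n + C * Real.log n ^ (2 * s - 2) * ppowLogSq n)
    {n : ℕ} (hn : ¬ Squarefree n) :
    (lambdaLog ^ s) n ≤ C * Real.log n ^ (2 * s - 2) * ppowLogSq n := by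
  have h := hC n
  rwa [sqMain, if_neg (fun h' => hn h'.1), mul_zero, zero_add] at h

/-- `Λ^{⋆j} ≥ 0`. [folklore] -/
theorem pow_vonMangoldt_nonneg : ∀ (j n : ℕ), 0 ≤ ((Λ : ArithmeticFunction ℝ) ^ j) n
  | 0, n => by
    rw [pow_zero, ArithmeticFunction.one_apply]
    split_ifs <;> norm_num
  | j + 1, n => by
    rw [pow_succ', ArithmeticFunction.mul_apply]
    exact Finset.sum_nonneg fun y _ => mul_nonneg vonMangoldt_nonneg (pow_vonMangoldt_nonneg j _)

end BombieriPr

end Arithmetic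

section Analytic

open ArithmeticFunction BombieriVector BombieriP2 BombieriRoughCells
open scoped ArithmeticFunction.omega

namespace BombieriPr

/-! ### The polynomial weight `Λ̃ = ∑_a (c_a/(log x)^a) Λ log^{a−1}` and its Dirichlet powers -/

/-- The polynomial test function `h(t) = ∑_{2 ≤ a ≤ K} c_a t^a` (no constant or linear term). [folklore] -/
def hpoly (c : ℕ → ℝ) (K : ℕ) (t : ℝ) : ℝ := ∑ a ∈ Icc 2 K, c a * t ^ a

/-- `∑_{2 ≤ a ≤ K} |c_a|`. [folklore] -/
def cAbs (c : ℕ → ℝ) (K : ℕ) : ℝ := ∑ a ∈ Icc 2 K, |c a|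

/-- `0 ≤ ∑ |c_a|`. [folklore] -/
theorem cAbs_nonneg (c : ℕ → ℝ) (K : ℕ) : 0 ≤ cAbs c K := Finset.sum_nonneg fun _ _ => abs_nonneg _

/-- The `P_s`-numbers up to `x`: squarefree `n ≤ ⌊x⌋` with `ω(n) = s`. [folklore] -/
def Ps (s : ℕ) (x : ℝ) : Finset ℕ := (Finset.Icc 1 ⌊x⌋₊).filter (fun n : ℕ => Squarefree n ∧ ω n = s)

/-- Membership in `Ps`. [folklore] -/
theorem mem_Ps {s : ℕ} {x : ℝ} {n : ℕ} :
    n ∈ Ps s x ↔ (1 ≤ n ∧ n ≤ ⌊x⌋₊) ∧ Squarefree n ∧ n.primeFactors.card = s := by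
  rw [Ps, Finset.mem_filter, Finset.mem_Icc, cardDistinctFactors_apply, ← List.card_toFinset,
    Nat.toFinset_factors]

/-- `Λ̃_{c,K,L} = ∑_{2 ≤ a ≤ K} (c_a/L^a) Λ log^{a−1}`, an arithmetic function supported on prime powers with
`Λ̃(p) = h(log p/L)`. [folklore] -/
def lamPoly (c : ℕ → ℝ) (K : ℕ) (L : ℝ) : ArithmeticFunction ℝ :=
  ∑ a ∈ Icc 2 K, (c a / L ^ a) • ev (Pw (a - 1))

/-- Its free-model preimage `∑_a (c_a/L^a) P_{a−1}`. [folklore] -/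
def polyX (c : ℕ → ℝ) (K : ℕ) (L : ℝ) : MvPolynomial ℕ ℝ :=
  ∑ a ∈ Icc 2 K, MvPolynomial.C (c a / L ^ a) * Pw (a - 1)

variable {c : ℕ → ℝ} {K : ℕ} {L : ℝ}

/-- `Λ̃(n) = ∑_a (c_a/L^a) Λ(n)(log n)^{a−1}`. [folklore] -/
theorem lamPoly_apply (c : ℕ → ℝ) (K : ℕ) (L : ℝ) (n : ℕ) :
    lamPoly c K L n = ∑ a ∈ Icc 2 K, c a / L ^ a * (Λ n * Real.log n ^ (a - 1)) := by
  classical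
  unfold lamPoly
  have key : ∀ t : Finset ℕ, (∑ a ∈ t, (c a / L ^ a) • ev (Pw (a - 1))) n =
      ∑ a ∈ t, ((c a / L ^ a) • ev (Pw (a - 1))) n := by
    intro t
    induction t using Finset.induction_on with
    | empty => simp
    | insert a t ha ih => rw [Finset.sum_insert ha, Finset.sum_insert ha, ArithmeticFunction.add_apply, ih]
  rw [key]
  refine Finset.sum_congr rfl fun a _ => ?_
  rw [ArithmeticFunction.smul_map, ev_Pw_apply, smul_eq_mul]

/-- `Λ̃` vanishes off the prime powers. [folklore] -/
theorem lamPoly_eq_zero (c : ℕ → ℝ) (K : ℕ) (L : ℝ) {n : ℕ} (h : ¬ IsPrimePow n) : lamPoly c K L n = 0 := by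
  rw [lamPoly_apply]
  simp [vonMangoldt_eq_zero_iff.mpr h]

/-- `Λ̃(p) = h(log p/L)` at a prime (`L ≠ 0`). [folklore] -/
theorem lamPoly_prime (c : ℕ → ℝ) (K : ℕ) {L : ℝ} (hL : L ≠ 0) {p : ℕ} (hp : p.Prime) :
    lamPoly c K L p = hpoly c K (Real.log p / L) := by
  rw [lamPoly_apply, hpoly]
  refine Finset.sum_congr rfl fun a ha => ?_
  have ha2 : 2 ≤ a := (Finset.mem_Icc.mp ha).1
  have hpow : Real.log p * Real.log p ^ (a - 1) = Real.log p ^ a := by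
    rw [← pow_succ', Nat.sub_add_cancel (by omega)]
  rw [vonMangoldt_apply_prime hp, hpow, div_pow]
  field_simp

/-- `ev(polyX) = Λ̃`. [folklore] -/
theorem ev_polyX (c : ℕ → ℝ) (K : ℕ) (L : ℝ) : ev (polyX c K L) = lamPoly c K L := by
  unfold polyX lamPoly
  rw [map_sum]
  exact Finset.sum_congr rfl fun a _ => ev_C_mul _ _

/-- **Multinomial expansion**: `polyX^s = ∑_e (∏ c_{eᵢ}/L^{eᵢ}) f_e` over tuples `e ∈ [2, K]^s`. [folklore] -/
theorem polyX_pow (c : ℕ → ℝ) (K : ℕ) (L : ℝ) (s : ℕ) :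
    polyX c K L ^ s = ∑ e ∈ Fintype.piFinset (fun _ : Fin s => Icc 2 K),
      MvPolynomial.C (∏ i, c (e i) / L ^ (e i)) * PwProd e := by
  calc polyX c K L ^ s = ∏ _i : Fin s, polyX c K L := by
        rw [Finset.prod_const, Finset.card_univ, Fintype.card_fin]
    _ = ∑ e ∈ Fintype.piFinset (fun _ : Fin s => Icc 2 K),
          ∏ i, (MvPolynomial.C (c (e i) / L ^ (e i)) * Pw (e i - 1)) := Finset.prod_univ_sum _ _
    _ = _ := Finset.sum_congr rfl fun e _ => by rw [Finset.prod_mul_distrib, map_prod, PwProd]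

/-- `Λ̃^{⋆s}(n) = ∑_e (∏ c_{eᵢ}/L^{eᵢ}) f_e(n)`. [folklore] -/
theorem lamPoly_pow_apply (c : ℕ → ℝ) (K : ℕ) (L : ℝ) (s n : ℕ) :
    (lamPoly c K L ^ s) n = ∑ e ∈ Fintype.piFinset (fun _ : Fin s => Icc 2 K),
      (∏ i, c (e i) / L ^ (e i)) * ev (PwProd e) n := by
  classical
  have key : ∀ (t : Finset (Fin s → ℕ)) (f : (Fin s → ℕ) → ArithmeticFunction ℝ),
      (∑ e ∈ t, f e) n = ∑ e ∈ t, f e n := by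
    intro t f
    induction t using Finset.induction_on with
    | empty => simp
    | insert a t ha ih => rw [Finset.sum_insert ha, Finset.sum_insert ha, ArithmeticFunction.add_apply, ih]
  rw [← ev_polyX, ← map_pow, polyX_pow, map_sum, key]
  exact Finset.sum_congr rfl fun e _ => by rw [ev_C_mul, ArithmeticFunction.smul_map, smul_eq_mul]

/-- **Domination**: `|Λ̃(d)| ≤ (∑|c_a|/L²)·Λ(d) log d` when `1 ≤ L` and `log d ≤ L`. [folklore] -/
theorem abs_lamPoly_le (c : ℕ → ℝ) (K : ℕ) {L : ℝ} (hL : 1 ≤ L) {d : ℕ} (hd : Real.log d ≤ L) :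
    |lamPoly c K L d| ≤ cAbs c K / L ^ 2 * lambdaLog d := by
  have hL0 : 0 < L := by linarith
  have hld : 0 ≤ Real.log d := Real.log_natCast_nonneg d
  rw [lamPoly_apply, lambdaLog_apply, cAbs, Finset.sum_div, Finset.sum_mul]
  refine (Finset.abs_sum_le_sum_abs _ _).trans (Finset.sum_le_sum fun a ha => ?_)
  have ha2 : 2 ≤ a := (Finset.mem_Icc.mp ha).1
  rw [abs_mul, abs_div, abs_of_pos (pow_pos hL0 a), abs_of_nonneg (mul_nonneg vonMangoldt_nonneg (pow_nonneg hld _))]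
  have hkey : Real.log d ^ (a - 1) / L ^ a ≤ Real.log d / L ^ 2 := by
    obtain ⟨b, rfl⟩ : ∃ b, a = b + 2 := ⟨a - 2, by omega⟩
    rw [show b + 2 - 1 = b + 1 from rfl, pow_succ, pow_add, div_le_div_iff₀ (by positivity) (by positivity)]
    have h1 : Real.log d ^ b ≤ L ^ b := pow_le_pow_left₀ hld hd b
    have h2 : 0 ≤ Real.log d * L ^ 2 := by positivity
    calc Real.log d ^ b * Real.log d * L ^ 2 = Real.log d ^ b * (Real.log d * L ^ 2) := by ring
      _ ≤ L ^ b * (Real.log d * L ^ 2) := mul_le_mul_of_nonneg_right h1 h2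
      _ = Real.log d * (L ^ b * L ^ 2) := by ring
  calc |c a| / L ^ a * (Λ d * Real.log d ^ (a - 1)) = |c a| * Λ d * (Real.log d ^ (a - 1) / L ^ a) := by ring
    _ ≤ |c a| * Λ d * (Real.log d / L ^ 2) :=
        mul_le_mul_of_nonneg_left hkey (mul_nonneg (abs_nonneg _) vonMangoldt_nonneg)
    _ = |c a| / L ^ 2 * (Λ d * Real.log d) := by ring

/-! ### The sums: squarefree part, junk, and the swap of the junk sum -/

/-- **The squarefree part is the `P_s`-sum of the product weight**:
`∑_{n ≤ x squarefree} a_n Λ̃^{⋆s}(n) = s! ∑_{n ∈ P_s(x)} a_n ∏_{p∣n} h(log p/log x)`. [folklore] -/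
theorem sum_squarefree_eq (A : SieveSequence) (c : ℕ → ℝ) (K s : ℕ) {x : ℝ} (hL : Real.log x ≠ 0) :
    ∑ n ∈ (Ioc 0 ⌊x⌋₊).filter Squarefree, A.a n * (lamPoly c K (Real.log x) ^ s) n =
      ((s.factorial : ℕ) : ℝ) * ∑ n ∈ Ps s x, A.a n *
        ∏ p ∈ n.primeFactors, hpoly c K (Real.log p / Real.log x) := by
  rw [Finset.mul_sum]
  have hsub : Ps s x = ((Ioc 0 ⌊x⌋₊).filter Squarefree).filter (fun n : ℕ => n.primeFactors.card = s) := by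
    ext n
    rw [mem_Ps, Finset.mem_filter, Finset.mem_filter, Finset.mem_Ioc]
    constructor
    · rintro ⟨⟨h1, h2⟩, h3, h4⟩; exact ⟨⟨⟨h1, h2⟩, h3⟩, h4⟩
    · rintro ⟨⟨⟨h1, h2⟩, h3⟩, h4⟩; exact ⟨⟨h1, h2⟩, h3, h4⟩
  rw [hsub, Finset.sum_filter (fun n : ℕ => n.primeFactors.card = s)]
  refine Finset.sum_congr rfl fun n hn => ?_
  have hsq : Squarefree n := (Finset.mem_filter.mp hn).2
  rw [pow_apply_squarefree (fun m hm => lamPoly_eq_zero c K (Real.log x) hm) s hsq]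
  split_ifs with h
  · rw [Finset.prod_congr rfl fun p hp => lamPoly_prime c K hL (Nat.prime_of_mem_primeFactors hp)]
    ring
  · rw [mul_zero]

/-- **Swapping the junk sum**: `∑_{n ≤ x} a_n Q(n) = ∑_{D ≤ x proper prime power} (log D)² A(x; D)`. [folklore] -/
theorem sum_ppowLogSq_eq (A : SieveSequence) (x : ℝ) :
    ∑ n ∈ Ioc 0 ⌊x⌋₊, A.a n * ppowLogSq n = ∑ D ∈ ppowSet x, Real.log D ^ 2 * A.congrSum D x := by
  simp only [ppowLogSq, ppowSet, SieveSequence.congrSum, Finset.mul_sum]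
  rw [Finset.sum_comm' (t' := (Ioc 0 ⌊x⌋₊).filter (fun D : ℕ => IsPrimePow D ∧ ¬ D.Prime))
    (s' := fun D => (Ioc 0 ⌊x⌋₊).filter (D ∣ ·))]
  · exact Finset.sum_congr rfl fun D _ => Finset.sum_congr rfl fun n _ => by ring
  · intro n D
    simp only [Finset.mem_filter, Finset.mem_Ioc, Nat.mem_divisors]
    constructor
    · rintro ⟨⟨hn0, hnN⟩, ⟨hDn, -⟩, hP⟩
      exact ⟨⟨⟨hn0, hnN⟩, hDn⟩, ⟨Nat.pos_of_dvd_of_pos hDn hn0, (Nat.le_of_dvd hn0 hDn).trans hnN⟩, hP⟩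
    · rintro ⟨⟨⟨hn0, hnN⟩, hDn⟩, ⟨_, _⟩, hP⟩
      exact ⟨⟨hn0, hnN⟩, ⟨hDn, hn0.ne'⟩, hP⟩

/-- **The junk is `O(A(x)/log² x)`**: `|∑_{n ≤ x, n not squarefree} a_n Λ̃^{⋆s}(n)| ≤ C A(x)/(log x)²`
eventually (`s ≥ 1`). [folklore] -/
theorem junk_isBigO {A : SieveSequence} (hA : A.IsBombieriSequence) (c : ℕ → ℝ) (K : ℕ) {s : ℕ}
    (hs : 1 ≤ s) :
    (fun x : ℝ => ∑ n ∈ (Ioc 0 ⌊x⌋₊).filter (fun n => ¬ Squarefree n),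
        A.a n * (lamPoly c K (Real.log x) ^ s) n) =O[atTop]
      fun x : ℝ => A.size x / Real.log x ^ 2 := by
  obtain ⟨Cs, hCs0, hCs⟩ := lambdaLog_pow_le hs
  obtain ⟨CJ, hCJ⟩ := junk_bound hA 2
  have hXnn : ∀ y, 0 ≤ A.size y := SieveSequence.size_nonneg_of_size_eq hA.1
  refine IsBigO.of_bound (cAbs c K ^ s * Cs * CJ) ?_
  filter_upwards [hCJ, eventually_ge_atTop (Real.exp 1)] with x hxJ hxe
  have hx1 : 1 < x := lt_of_lt_of_le (by have := Real.exp_one_gt_d9; linarith) hxe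
  have hx0 : 0 < x := by linarith
  have hL1 : 1 ≤ Real.log x := by rw [← Real.log_exp 1]; exact Real.log_le_log (Real.exp_pos 1) hxe
  have hL0 : 0 < Real.log x := by linarith
  set L := Real.log x with hL
  set N := ⌊x⌋₊ with hN
  have hK0 : 0 ≤ cAbs c K ^ s * Cs / L ^ 2 :=
    div_nonneg (mul_nonneg (pow_nonneg (cAbs_nonneg c K) s) hCs0) (sq_nonneg L)
  -- pointwise bound for `n ≤ N` not squarefree
  have hlogle : ∀ n : ℕ, n ≤ N → Real.log n ≤ L := fun n hn => by
    rcases Nat.eq_zero_or_pos n with rfl | hn0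
    · simp [hL0.le]
    · exact Real.log_le_log (by exact_mod_cast hn0) ((Nat.cast_le.mpr hn).trans (Nat.floor_le hx0.le))
  have hdom : ∀ d : ℕ, d ≤ N → |lamPoly c K L d| ≤ ((cAbs c K / L ^ 2) • lambdaLog) d := fun d hd => by
    rw [ArithmeticFunction.smul_map, smul_eq_mul]
    exact abs_lamPoly_le c K hL1 (hlogle d hd)
  have hpt : ∀ n ∈ (Ioc 0 N).filter (fun n => ¬ Squarefree n),
      |A.a n * (lamPoly c K L ^ s) n| ≤ cAbs c K ^ s * Cs / L ^ 2 * (A.a n * ppowLogSq n) := by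
    intro n hn
    obtain ⟨hn, hnsq⟩ := Finset.mem_filter.mp hn
    have hnN : n ≤ N := (Finset.mem_Ioc.mp hn).2
    have h1 := abs_pow_apply_le hdom s hnN
    rw [smul_pow, ArithmeticFunction.smul_map, smul_eq_mul] at h1
    have h2 := lambdaLog_pow_le_of_not_squarefree hCs hnsq
    have h3 : Real.log n ^ (2 * s - 2) ≤ L ^ (2 * s - 2) :=
      pow_le_pow_left₀ (Real.log_natCast_nonneg n) (hlogle n hnN) _
    have hQ := ppowLogSq_nonneg n
    have h4 : (lambdaLog ^ s) n ≤ Cs * L ^ (2 * s - 2) * ppowLogSq n :=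
      h2.trans (mul_le_mul_of_nonneg_right (mul_le_mul_of_nonneg_left h3 hCs0) hQ)
    rw [abs_mul, abs_of_nonneg (A.a_nonneg n)]
    have h5 : |(lamPoly c K L ^ s) n| ≤ (cAbs c K / L ^ 2) ^ s * (Cs * L ^ (2 * s - 2) * ppowLogSq n) :=
      h1.trans (mul_le_mul_of_nonneg_left h4 (pow_nonneg (div_nonneg (cAbs_nonneg c K) (sq_nonneg L)) s))
    have h6 : (cAbs c K / L ^ 2) ^ s * (Cs * L ^ (2 * s - 2) * ppowLogSq n) =
        cAbs c K ^ s * Cs / L ^ 2 * ppowLogSq n := by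
      have hL2s : L ^ (2 * s) = L ^ (2 * s - 2) * L ^ 2 := by
        rw [← pow_add]; congr 1; omega
      rw [div_pow, ← pow_mul, hL2s]
      have hne : L ^ (2 * s - 2) ≠ 0 := pow_ne_zero _ hL0.ne'
      field_simp
    rw [h6] at h5
    calc A.a n * |(lamPoly c K L ^ s) n| ≤ A.a n * (cAbs c K ^ s * Cs / L ^ 2 * ppowLogSq n) :=
          mul_le_mul_of_nonneg_left h5 (A.a_nonneg n)
      _ = _ := by ring
  rw [Real.norm_eq_abs, Real.norm_eq_abs, abs_of_nonneg (div_nonneg (hXnn x) (sq_nonneg _))]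
  calc |∑ n ∈ (Ioc 0 N).filter (fun n => ¬ Squarefree n), A.a n * (lamPoly c K L ^ s) n|
      ≤ ∑ n ∈ (Ioc 0 N).filter (fun n => ¬ Squarefree n), |A.a n * (lamPoly c K L ^ s) n| :=
        Finset.abs_sum_le_sum_abs _ _
    _ ≤ ∑ n ∈ (Ioc 0 N).filter (fun n => ¬ Squarefree n), cAbs c K ^ s * Cs / L ^ 2 * (A.a n * ppowLogSq n) :=
        Finset.sum_le_sum hpt
    _ ≤ ∑ n ∈ Ioc 0 N, cAbs c K ^ s * Cs / L ^ 2 * (A.a n * ppowLogSq n) :=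
        Finset.sum_le_sum_of_subset_of_nonneg (Finset.filter_subset _ _) fun n _ _ =>
          mul_nonneg hK0 (mul_nonneg (A.a_nonneg n) (ppowLogSq_nonneg n))
    _ = cAbs c K ^ s * Cs / L ^ 2 * ∑ D ∈ ppowSet x, Real.log D ^ 2 * A.congrSum D x := by
        rw [← Finset.mul_sum, sum_ppowLogSq_eq]
    _ ≤ cAbs c K ^ s * Cs / L ^ 2 * (CJ * A.size x) := mul_le_mul_of_nonneg_left hxJ hK0
    _ = cAbs c K ^ s * Cs * CJ * (A.size x / L ^ 2) := by ring

/-! ### The law for one tuple `e` -/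

/-- **The law for `f_e`**: `∑_{n ≤ x} a_n f_e(n) = I_e (log x)^{|e|} M_s(x) + o(A(x)(log x)^{|e|−1})` for a
tuple `e` of exponents `≥ 2` (`s ≥ 1`). [folklore] -/
theorem tuple_law (hV : Bombieri1976_asymptotic_sieve_vector) {A : SieveSequence} {H : ℝ}
    (hA : A.IsBombieriSequence) (hH : A.HasDensityConstant H) {s : ℕ} (hs : 1 ≤ s) (e : Fin s → ℕ)
    (he : ∀ i, 2 ≤ e i) :
    (fun x : ℝ => ∑ n ∈ Ioc 0 ⌊x⌋₊, ev (PwProd e) n * A.a n -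
        tupleWeight e * Real.log x ^ (∑ i, e i) * mainTerm A H s x) =o[atTop]
      fun x : ℝ => A.size x * Real.log x ^ ((∑ i, e i) - 1) := by
  set m := ∑ i, e i with hm
  have he1 : ∀ i, 1 ≤ e i := fun i => le_trans one_le_two (he i)
  have hm2 : 2 ≤ m := by
    obtain ⟨i⟩ : Nonempty (Fin s) := ⟨⟨0, hs⟩⟩
    exact le_trans (he i) (Finset.single_le_sum (fun j _ => Nat.zero_le (e j)) (Finset.mem_univ i))
  have hXnn : ∀ y, 0 ≤ A.size y := SieveSequence.size_nonneg_of_size_eq hA.1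
  -- the three `o`-inputs
  have h1 := univ_PwBal hV hA hH hs e he1
  have h2 := primes_powlog_defect_isLittleO hA hH (k := m) (by omega)
  have h3 : (fun x : ℝ => ∑ d ∈ ppowSet x, Λ d * Real.log d ^ (m - 1) * A.a d) =o[atTop]
      fun x : ℝ => A.size x * Real.log x ^ (m - 1) := by
    obtain ⟨CJ, hCJ⟩ := junk_bound hA m
    have hO : (fun x : ℝ => ∑ d ∈ ppowSet x, Λ d * Real.log d ^ (m - 1) * A.a d) =O[atTop]
        fun x : ℝ => A.size x := by
      refine IsBigO.of_bound CJ ?_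
      filter_upwards [hCJ, eventually_ge_atTop (1 : ℝ)] with x hx hx1
      have hnn : ∀ d ∈ ppowSet x, 0 ≤ Λ d * Real.log d ^ (m - 1) * A.a d := fun d _ =>
        mul_nonneg (mul_nonneg vonMangoldt_nonneg (pow_nonneg (Real.log_natCast_nonneg d) _)) (A.a_nonneg d)
      rw [Real.norm_eq_abs, abs_of_nonneg (Finset.sum_nonneg hnn), Real.norm_eq_abs, abs_of_nonneg (hXnn x)]
      refine le_trans (Finset.sum_le_sum fun d hd => ?_) hx
      have hd' := (Finset.mem_filter.mp hd).1
      have hld : 0 ≤ Real.log d := Real.log_natCast_nonneg d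
      calc Λ d * Real.log d ^ (m - 1) * A.a d ≤ Real.log d * Real.log d ^ (m - 1) * A.congrSum d x :=
            mul_le_mul (mul_le_mul_of_nonneg_right vonMangoldt_le_log (pow_nonneg hld _))
              (a_le_congrSum A hd') (A.a_nonneg d) (mul_nonneg hld (pow_nonneg hld _))
        _ = Real.log d ^ m * A.congrSum d x := by
            rw [← pow_succ', Nat.sub_add_cancel (by omega)]
    refine hO.trans_isLittleO ?_
    -- `A = o(A (log x)^{m-1})`
    refine isLittleO_iff.mpr fun ε hε => ?_
    filter_upwards [Real.tendsto_log_atTop.eventually_ge_atTop (max 1 (1 / ε)),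
      eventually_gt_atTop (1 : ℝ)] with x hx hx1
    have hL : 0 < Real.log x := Real.log_pos hx1
    have hL1' : 1 ≤ Real.log x := le_trans (le_max_left _ _) hx
    have hL1 : 1 / ε ≤ Real.log x ^ (m - 1) :=
      le_trans (le_trans (le_max_right _ _) hx) (le_self_pow₀ hL1' (by omega))
    rw [Real.norm_eq_abs, Real.norm_eq_abs, abs_of_nonneg (hXnn x),
      abs_of_nonneg (mul_nonneg (hXnn x) (pow_nonneg hL.le _))]
    have : 1 ≤ ε * Real.log x ^ (m - 1) := by
      rw [div_le_iff₀ hε] at hL1; linarith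
    nlinarith [hXnn x]
  -- the identity
  have hsplit : ∀ x : ℝ, ∑ n ∈ Ioc 0 ⌊x⌋₊, ev (PwProd e) n * A.a n =
      (∑ n ∈ Ioc 0 ⌊x⌋₊, ev (PwBal e) n * A.a n) + (-1 : ℝ) ^ (s + 1) * tupleWeight e *
        ((∑ p ∈ Nat.primesLE ⌊x⌋₊, A.a p * Real.log p ^ m) +
          ∑ d ∈ ppowSet x, Λ d * Real.log d ^ (m - 1) * A.a d) := by
    intro x
    have hsp := sum_vonMangoldt_logpow_split A (m - 1) x
    rw [Nat.sub_add_cancel (by omega)] at hsp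
    rw [← hsp, Finset.mul_sum, ← Finset.sum_add_distrib]
    refine Finset.sum_congr rfl fun n _ => ?_
    rw [ev_PwBal_apply]
    ring
  have hdef : ∀ x : ℝ, (∑ p ∈ Nat.primesLE ⌊x⌋₊, A.a p * Real.log p ^ m) =
      Real.log x ^ m * (∑ p ∈ Nat.primesLE ⌊x⌋₊, A.a p) -
        ∑ p ∈ Nat.primesLE ⌊x⌋₊, A.a p * (Real.log x ^ m - Real.log p ^ m) := by
    intro x
    rw [Finset.mul_sum, ← Finset.sum_sub_distrib]
    exact Finset.sum_congr rfl fun p _ => by ring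
  have key := (h1.sub ((h2.const_mul_left ((-1 : ℝ) ^ (s + 1) * tupleWeight e)))).add
    (h3.const_mul_left ((-1 : ℝ) ^ (s + 1) * tupleWeight e))
  refine key.congr' ?_ EventuallyEq.rfl
  filter_upwards [eventually_gt_atTop (1 : ℝ)] with x hx1
  have hL : Real.log x ≠ 0 := (Real.log_pos hx1).ne'
  rw [hsplit x, hdef x]
  unfold mainTerm
  have hpow : Real.log x ^ m = Real.log x ^ (m - 1) * Real.log x := by
    rw [← pow_succ, Nat.sub_add_cancel (by omega)]
  rw [hpow]
  field_simp
  ring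

/-! ### The law for polynomial product weights -/

/-- **Bombieri's law on `P_s` for polynomial product weights.** For `s ≥ 1` and
`h(t) = ∑_{2 ≤ a ≤ K} c_a t^a` there is `J = J(s, h) ∈ ℝ` such that for every sieve sequence `A`
with Bombieri's (A₁)–(A₅) and density constant `H`,
`∑_{n ≤ x, n squarefree, ω(n) = s} a_n ∏_{p ∣ n} h(log p/log x) = J · M_s(x) + o(A(x)/log x)`,
`M_s(x) = (1 + (−1)^s) H A(x)/log x − (−1)^s ∑_{p ≤ x} a_p`. (Explicitly
`J = (1/s!) ∑_{e ∈ [2,K]^s} (∏ c_{eᵢ}) ∏(eᵢ−1)!/(|e|−1)!`, i.e. `∫_{T_s} ∏ h(uᵢ) dμ_s`, a form not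
needed here.) [cite: BombieriRIMS1977, p. 5 Theorem and p. 6] -/
theorem productLaw_poly (hV : Bombieri1976_asymptotic_sieve_vector) {s : ℕ} (hs : 1 ≤ s)
    (c : ℕ → ℝ) (K : ℕ) :
    ∃ J : ℝ, ∀ (A : SieveSequence) (H : ℝ), A.IsBombieriSequence → A.HasDensityConstant H →
      (fun x : ℝ => ∑ n ∈ Ps s x, A.a n * ∏ p ∈ n.primeFactors, hpoly c K (Real.log p / Real.log x) -
          J * mainTerm A H s x) =o[atTop]
        fun x : ℝ => A.size x / Real.log x := by
  set E := Fintype.piFinset (fun _ : Fin s => Icc 2 K) with hE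
  set J : ℝ := (1 / ((s.factorial : ℕ) : ℝ)) * ∑ e ∈ E, (∏ i, c (e i)) * tupleWeight e with hJ
  refine ⟨J, fun A H hA hH => ?_⟩
  have hXnn : ∀ y, 0 ≤ A.size y := SieveSequence.size_nonneg_of_size_eq hA.1
  have hsf : ((s.factorial : ℕ) : ℝ) ≠ 0 := by exact_mod_cast Nat.factorial_ne_zero s
  have hmem : ∀ e ∈ E, ∀ i, 2 ≤ e i := fun e he i =>
    (Finset.mem_Icc.mp (Fintype.mem_piFinset.mp he i)).1
  -- the main error term: sum over tuples
  have hmain : (fun x : ℝ => ∑ e ∈ E, (∏ i, c (e i) / Real.log x ^ (e i)) *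
      (∑ n ∈ Ioc 0 ⌊x⌋₊, ev (PwProd e) n * A.a n -
        tupleWeight e * Real.log x ^ (∑ i, e i) * mainTerm A H s x)) =o[atTop]
      fun x : ℝ => A.size x / Real.log x := by
    refine IsLittleO.sum fun e he => ?_
    have ht := tuple_law hV hA hH hs e (hmem e he)
    have hm1 : 1 ≤ ∑ i, e i := by
      obtain ⟨i⟩ : Nonempty (Fin s) := ⟨⟨0, hs⟩⟩
      exact le_trans (le_trans one_le_two (hmem e he i))
        (Finset.single_le_sum (fun j _ => Nat.zero_le (e j)) (Finset.mem_univ i))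
    have hκ : (fun x : ℝ => ∏ i, c (e i) / Real.log x ^ (e i)) =O[atTop]
        fun x : ℝ => (Real.log x ^ (∑ i, e i))⁻¹ := by
      refine IsBigO.of_bound (|∏ i, c (e i)|) ?_
      filter_upwards [eventually_gt_atTop (1 : ℝ)] with x hx1
      have hL : 0 < Real.log x := Real.log_pos hx1
      rw [Finset.prod_div_distrib, Finset.prod_pow_eq_pow_sum, Real.norm_eq_abs, Real.norm_eq_abs,
        abs_div, abs_inv, abs_of_pos (pow_pos hL _), div_eq_mul_inv]
    refine (hκ.mul_isLittleO ht).trans_isBigO ?_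
    refine IsBigO.of_bound 1 ?_
    filter_upwards [eventually_gt_atTop (1 : ℝ)] with x hx1
    have hL : 0 < Real.log x := Real.log_pos hx1
    rw [one_mul, Real.norm_eq_abs, Real.norm_eq_abs, abs_of_nonneg (div_nonneg (hXnn x) hL.le),
      abs_of_nonneg (mul_nonneg (inv_nonneg.mpr (pow_nonneg hL.le _)) (mul_nonneg (hXnn x) (pow_nonneg hL.le _)))]
    have : (Real.log x ^ (∑ i, e i))⁻¹ * (A.size x * Real.log x ^ ((∑ i, e i) - 1)) = A.size x / Real.log x := by
      have hpow : Real.log x ^ (∑ i, e i) = Real.log x ^ ((∑ i, e i) - 1) * Real.log x := by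
        rw [← pow_succ, Nat.sub_add_cancel hm1]
      rw [hpow]
      field_simp
    rw [this]
  -- the junk
  have hjunk := ((junk_isBigO hA c K hs).trans_isLittleO
    (show (fun x : ℝ => A.size x / Real.log x ^ 2) =o[atTop] fun x : ℝ => A.size x / Real.log x from by
      refine isLittleO_iff.mpr fun ε hε => ?_
      filter_upwards [Real.tendsto_log_atTop.eventually_ge_atTop (1 / ε), eventually_gt_atTop (1 : ℝ)]
        with x hx hx1
      have hL : 0 < Real.log x := Real.log_pos hx1
      rw [Real.norm_eq_abs, Real.norm_eq_abs, abs_of_nonneg (div_nonneg (hXnn x) (sq_nonneg _)),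
        abs_of_nonneg (div_nonneg (hXnn x) hL.le), sq, div_mul_eq_div_div, div_le_iff₀ hL]
      rw [div_le_iff₀ hε] at hx
      calc A.size x / Real.log x = A.size x / Real.log x * 1 := (mul_one _).symm
        _ ≤ A.size x / Real.log x * (ε * Real.log x) :=
            mul_le_mul_of_nonneg_left (by linarith) (div_nonneg (hXnn x) hL.le)
        _ = ε * (A.size x / Real.log x) * Real.log x := by ring))
  -- assemble
  have key := (hmain.sub hjunk).const_mul_left (1 / ((s.factorial : ℕ) : ℝ))
  refine key.congr' ?_ EventuallyEq.rfl
  filter_upwards [eventually_gt_atTop (1 : ℝ)] with x hx1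
  have hL : Real.log x ≠ 0 := (Real.log_pos hx1).ne'
  -- the full sum, expanded over tuples and split at squarefree
  have hfull : ∑ n ∈ Ioc 0 ⌊x⌋₊, A.a n * (lamPoly c K (Real.log x) ^ s) n =
      ∑ e ∈ E, (∏ i, c (e i) / Real.log x ^ (e i)) * ∑ n ∈ Ioc 0 ⌊x⌋₊, ev (PwProd e) n * A.a n := by
    simp_rw [lamPoly_pow_apply, Finset.mul_sum]
    rw [Finset.sum_comm]
    exact Finset.sum_congr rfl fun e _ => Finset.sum_congr rfl fun n _ => by ring
  have hsplit := Finset.sum_filter_add_sum_filter_not (Ioc 0 ⌊x⌋₊) Squarefree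
    (fun n => A.a n * (lamPoly c K (Real.log x) ^ s) n)
  rw [sum_squarefree_eq A c K s hL, hfull] at hsplit
  have hκ : ∀ e ∈ E, (∏ i, c (e i) / Real.log x ^ (e i)) *
      (tupleWeight e * Real.log x ^ (∑ i, e i) * mainTerm A H s x) =
      (∏ i, c (e i)) * tupleWeight e * mainTerm A H s x := by
    intro e _
    rw [Finset.prod_div_distrib, Finset.prod_pow_eq_pow_sum]
    field_simp
  have hJ' : J * mainTerm A H s x = (1 / ((s.factorial : ℕ) : ℝ)) *
      ∑ e ∈ E, (∏ i, c (e i) / Real.log x ^ (e i)) *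
        (tupleWeight e * Real.log x ^ (∑ i, e i) * mainTerm A H s x) := by
    rw [Finset.sum_congr rfl hκ, hJ, mul_assoc, Finset.sum_mul]
  have hsum_sub : ∑ e ∈ E, (∏ i, c (e i) / Real.log x ^ (e i)) *
      (∑ n ∈ Ioc 0 ⌊x⌋₊, ev (PwProd e) n * A.a n -
        tupleWeight e * Real.log x ^ (∑ i, e i) * mainTerm A H s x) =
      ∑ e ∈ E, (∏ i, c (e i) / Real.log x ^ (e i)) * ∑ n ∈ Ioc 0 ⌊x⌋₊, ev (PwProd e) n * A.a n -
      ∑ e ∈ E, (∏ i, c (e i) / Real.log x ^ (e i)) *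
        (tupleWeight e * Real.log x ^ (∑ i, e i) * mainTerm A H s x) := by
    rw [← Finset.sum_sub_distrib]
    exact Finset.sum_congr rfl fun e _ => by ring
  rw [hsum_sub, hJ', ← hsplit]
  have hinv : (1 : ℝ) / ((s.factorial : ℕ) : ℝ) * ((s.factorial : ℕ) : ℝ) = 1 := by field_simp
  linear_combination (∑ n ∈ Ps s x, A.a n * ∏ p ∈ n.primeFactors,
    hpoly c K (Real.log p / Real.log x)) * hinv

/-! ### The Chebyshev bound for the bare product `∏_{p ∣ n} (log p/log x)` -/

/-- The convolution `(Λ·log) ⋆ Λ^{⋆(s−1)}` at a squarefree `n` with `ω(n) = s`: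
`= (s−1)! (∏_{p∣n} log p) · log n`. [folklore] -/
theorem lambdaLog_mul_pow_apply {s : ℕ} {n : ℕ} (hn : Squarefree n)
    (hcard : n.primeFactors.card = s) :
    (lambdaLog * Λ ^ (s - 1)) n =
      (((s - 1).factorial : ℕ) : ℝ) * (∏ p ∈ n.primeFactors, Real.log p) * Real.log n := by
  have hΛ : ∀ m : ℕ, ¬ IsPrimePow m → (Λ : ArithmeticFunction ℝ) m = 0 := fun m hm =>
    vonMangoldt_eq_zero_iff.mpr hm
  rw [mul_apply_squarefree (fun m hm => lambdaLog_eq_zero hm) _ hn]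
  have hterm : ∀ p ∈ n.primeFactors, lambdaLog p * (Λ ^ (s - 1)) (n / p) =
      (((s - 1).factorial : ℕ) : ℝ) * (∏ q ∈ n.primeFactors, Real.log q) * Real.log p := by
    intro p hp
    have hp' := Nat.prime_of_mem_primeFactors hp
    have hsq : Squarefree (n / p) := hn.squarefree_of_dvd (Nat.div_dvd_of_dvd (Nat.dvd_of_mem_primeFactors hp))
    have hpfdiv : (n / p).primeFactors = n.primeFactors.erase p := by
      have h := Nat.primeFactors_div_gcd hn hp'.ne_zero
      rw [Nat.gcd_eq_right (Nat.dvd_of_mem_primeFactors hp)] at h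
      rw [h, hp'.primeFactors, Finset.sdiff_singleton_eq_erase]
    rw [pow_apply_squarefree hΛ (s - 1) hsq, hpfdiv, Finset.card_erase_of_mem hp,
      hcard, if_pos rfl, lambdaLog_prime hp',
      Finset.prod_congr rfl fun q hq => vonMangoldt_apply_prime
        (Nat.prime_of_mem_primeFactors (Finset.mem_of_mem_erase hq)),
      ← Finset.mul_prod_erase _ (fun q : ℕ => Real.log (q : ℝ)) hp]
    ring
  rw [Finset.sum_congr rfl hterm, ← Finset.mul_sum]
  congr 1
  have h0 : ∀ p ∈ n.primeFactors, ((p : ℕ) : ℝ) ≠ 0 := fun p hp => by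
    exact_mod_cast (Nat.prime_of_mem_primeFactors hp).ne_zero
  rw [← Real.log_prod h0, ← Nat.cast_prod, Nat.prod_primeFactors_of_squarefree hn]

/-- `Λ₂ ⋆ G ≥ (Λ·log) ⋆ G` pointwise for `G ≥ 0` (`Λ₂ = Λ·log + Λ ⋆ Λ`). [folklore] -/
theorem lambdaLog_mul_le {G : ArithmeticFunction ℝ} (hG : ∀ n, 0 ≤ G n) (n : ℕ) :
    (lambdaLog * G) n ≤ (generalizedVonMangoldt 2 * G) n := by
  rw [ArithmeticFunction.mul_apply, ArithmeticFunction.mul_apply]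
  refine Finset.sum_le_sum fun y _ => mul_le_mul_of_nonneg_right ?_ (hG _)
  rw [show (2 : ℕ) = 1 + 1 from rfl, generalizedVonMangoldt_succ, generalizedVonMangoldt_one,
    ArithmeticFunction.add_apply]
  have : 0 ≤ (Λ * Λ : ArithmeticFunction ℝ) y.1 := by
    rw [ArithmeticFunction.mul_apply]
    exact Finset.sum_nonneg fun z _ => mul_nonneg vonMangoldt_nonneg vonMangoldt_nonneg
  have hl : (ArithmeticFunction.vonMangoldt.pmul ArithmeticFunction.log : ArithmeticFunction ℝ) y.1 =
      lambdaLog y.1 := rfl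
  rw [hl]
  linarith

/-- **Chebyshev bound for the bare product.** For `s ≥ 1` there is `C` with
`∑_{n ≤ x, n squarefree, ω(n) = s} a_n ∏_{p ∣ n} (log p/log x) ≤ C A(x)/log x` for all large `x`
(Theorem 1 for the vector `(2, 1, …, 1)` on `n > √x`, and `A(√x) = o(A(x)/log x)` below). [folklore] -/
theorem primeProd_log_le (hV : Bombieri1976_asymptotic_sieve_vector) {A : SieveSequence} {H : ℝ}
    (hA : A.IsBombieriSequence) (hH : A.HasDensityConstant H) {s : ℕ} (hs : 1 ≤ s) :
    ∃ C : ℝ, 0 ≤ C ∧ ∀ᶠ x : ℝ in atTop,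
      ∑ n ∈ Ps s x, A.a n * ∏ p ∈ n.primeFactors, (Real.log p / Real.log x) ≤
        C * A.size x / Real.log x := by
  classical
  have hsize := hA.1
  have hXnn : ∀ y, 0 ≤ A.size y := SieveSequence.size_nonneg_of_size_eq hsize
  have hH0 : 0 ≤ H := SieveSequence.HasDensityConstant.nonneg_of_bombieriA1 hH hA.2.1
  set ks : List ℕ := 2 :: List.replicate (s - 1) 1 with hks
  have hks2 : ∃ k ∈ ks, 2 ≤ k := ⟨2, by simp [hks], le_rfl⟩
  have hT := hV A H hA hH ks hks2
  have hsum : ks.sum = s + 1 := by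
    simp only [hks, List.sum_cons, List.sum_replicate, smul_eq_mul, mul_one]; omega
  have hprod : (ks.map generalizedVonMangoldt).prod = generalizedVonMangoldt 2 * Λ ^ (s - 1) := by
    simp only [hks, List.map_cons, List.map_replicate, List.prod_cons, List.prod_replicate,
      generalizedVonMangoldt_one]
  set γ : ℝ := ((ks.map Nat.factorial).prod : ℝ) / ((ks.sum - 1).factorial : ℝ) with hγ
  have hγ0 : 0 ≤ γ := by positivity
  rw [hprod, hsum, Nat.add_sub_cancel] at hT
  -- eventual bound `T(x) ≤ 2 γ H A (log x)^s`
  have hTev : ∀ᶠ x : ℝ in atTop, ∑ n ∈ Ioc 0 ⌊x⌋₊, (generalizedVonMangoldt 2 * Λ ^ (s - 1)) n * A.a n ≤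
      2 * (γ * H * A.size x * Real.log x ^ s) := by
    have h := hT.isLittleO.def one_pos
    filter_upwards [h, eventually_ge_atTop (1 : ℝ)] with x hx hx1
    have hv : 0 ≤ γ * H * A.size x * Real.log x ^ s :=
      mul_nonneg (mul_nonneg (mul_nonneg hγ0 hH0) (hXnn x)) (pow_nonneg (Real.log_nonneg hx1) _)
    rw [one_mul, Real.norm_eq_abs, Real.norm_eq_abs, abs_of_nonneg hv] at hx
    simp only [Pi.sub_apply] at hx
    have := (abs_le.mp hx).2
    linarith
  set C₁ : ℝ := 4 * γ * H / (((s - 1).factorial : ℕ) : ℝ) with hC₁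
  have hC₁0 : 0 ≤ C₁ := by positivity
  refine ⟨C₁ + 1, by positivity, ?_⟩
  have hsq := (size_sqrt_isLittleO hA).def one_pos
  filter_upwards [hTev, hsq, eventually_gt_atTop (1 : ℝ)] with x hTx hsqx hx1
  have hx0 : 0 < x := by linarith
  have hL : 0 < Real.log x := Real.log_pos hx1
  set L := Real.log x with hLdef
  set N := ⌊x⌋₊ with hN
  rw [one_mul, Real.norm_eq_abs, Real.norm_eq_abs, abs_of_nonneg (hXnn _),
    abs_of_nonneg (div_nonneg (hXnn x) hL.le)] at hsqx
  have hfact : (0 : ℝ) < (((s - 1).factorial : ℕ) : ℝ) := by exact_mod_cast Nat.factorial_pos _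
  -- facts about members of `Ps`
  have hmemb : ∀ n ∈ Ps s x, Squarefree n ∧ n.primeFactors.card = s ∧ 1 ≤ n ∧ (n : ℝ) ≤ x ∧
      (∀ p ∈ n.primeFactors, 0 ≤ Real.log p ∧ Real.log p ≤ L) := by
    intro n hn
    obtain ⟨⟨hn1, hnN⟩, hsqf, hcard⟩ := mem_Ps.mp hn
    have hnx : (n : ℝ) ≤ x := (Nat.cast_le.mpr hnN).trans (Nat.floor_le hx0.le)
    refine ⟨hsqf, hcard, hn1, hnx, fun p hp => ?_⟩
    have hp' := Nat.prime_of_mem_primeFactors hp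
    have hpn : (p : ℝ) ≤ n := by exact_mod_cast Nat.le_of_dvd hn1 (Nat.dvd_of_mem_primeFactors hp)
    exact ⟨Real.log_nonneg (by exact_mod_cast hp'.one_lt.le),
      Real.log_le_log (by exact_mod_cast hp'.pos) (hpn.trans hnx)⟩
  have hprodle : ∀ n ∈ Ps s x, ∏ p ∈ n.primeFactors, (Real.log p / L) ≤ 1 := fun n hn =>
    Finset.prod_le_one (fun p hp => div_nonneg ((hmemb n hn).2.2.2.2 p hp).1 hL.le)
      fun p hp => (div_le_one hL).mpr ((hmemb n hn).2.2.2.2 p hp).2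
  have hprod0 : ∀ n ∈ Ps s x, 0 ≤ ∏ p ∈ n.primeFactors, (Real.log p / L) := fun n hn =>
    Finset.prod_nonneg fun p hp => div_nonneg ((hmemb n hn).2.2.2.2 p hp).1 hL.le
  -- split at `√x`
  rw [← Finset.sum_filter_add_sum_filter_not (Ps s x) (fun n : ℕ => (n : ℝ) ≤ Real.sqrt x)]
  have hsmall : ∑ n ∈ (Ps s x).filter (fun n : ℕ => (n : ℝ) ≤ Real.sqrt x),
      A.a n * ∏ p ∈ n.primeFactors, (Real.log p / L) ≤ A.size x / L := by
    calc _ ≤ ∑ n ∈ (Ps s x).filter (fun n : ℕ => (n : ℝ) ≤ Real.sqrt x), A.a n := by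
          refine Finset.sum_le_sum fun n hn => ?_
          have hn' := (Finset.mem_filter.mp hn).1
          calc A.a n * ∏ p ∈ n.primeFactors, (Real.log p / L) ≤ A.a n * 1 :=
                mul_le_mul_of_nonneg_left (hprodle n hn') (A.a_nonneg n)
            _ = A.a n := mul_one _
      _ ≤ A.size (Real.sqrt x) := by
          refine sum_le_size hsize fun n hn => ?_
          obtain ⟨hn, hns⟩ := Finset.mem_filter.mp hn
          exact Finset.mem_Ioc.mpr ⟨(hmemb n hn).2.2.1, Nat.le_floor hns⟩
      _ ≤ A.size x / L := hsqx
  have hlarge : ∑ n ∈ (Ps s x).filter (fun n : ℕ => ¬ (n : ℝ) ≤ Real.sqrt x),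
      A.a n * ∏ p ∈ n.primeFactors, (Real.log p / L) ≤ C₁ * A.size x / L := by
    -- pointwise: `a_n ∏ (log p/L) ≤ (2/((s-1)! L^{s+1})) (Λ₂ ⋆ Λ^{s-1})(n) a_n`
    have hpt : ∀ n ∈ (Ps s x).filter (fun n : ℕ => ¬ (n : ℝ) ≤ Real.sqrt x),
        A.a n * ∏ p ∈ n.primeFactors, (Real.log p / L) ≤
          2 / ((((s - 1).factorial : ℕ) : ℝ) * L ^ (s + 1)) *
            ((generalizedVonMangoldt 2 * Λ ^ (s - 1)) n * A.a n) := by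
      intro n hn
      obtain ⟨hn, hns⟩ := Finset.mem_filter.mp hn
      obtain ⟨hsqf, hcard, hn1, hnx, hlogs⟩ := hmemb n hn
      have hn0 : (0 : ℝ) < n := by exact_mod_cast hn1
      have hlogn : L / 2 ≤ Real.log n := by
        have h := Real.log_le_log (Real.sqrt_pos.mpr hx0) (le_of_lt (not_le.mp hns))
        rwa [Real.log_sqrt hx0.le] at h
      have hkey := lambdaLog_mul_pow_apply hsqf hcard
      have hle := lambdaLog_mul_le (G := Λ ^ (s - 1)) (fun m => pow_vonMangoldt_nonneg (s - 1) m) n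
      rw [hkey] at hle
      have hP0 : 0 ≤ ∏ p ∈ n.primeFactors, Real.log (p : ℝ) := Finset.prod_nonneg fun p hp => (hlogs p hp).1
      have hprodeq : ∏ p ∈ n.primeFactors, (Real.log p / L) = (∏ p ∈ n.primeFactors, Real.log (p : ℝ)) / L ^ s := by
        rw [Finset.prod_div_distrib, Finset.prod_const, hcard]
      rw [hprodeq]
      -- `(s-1)! ∏ log p · (L/2) ≤ (s-1)! ∏ log p · log n ≤ (Λ₂ ⋆ Λ^{s-1})(n)`
      have h1 : (((s - 1).factorial : ℕ) : ℝ) * (∏ p ∈ n.primeFactors, Real.log (p : ℝ)) * (L / 2) ≤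
          (generalizedVonMangoldt 2 * Λ ^ (s - 1)) n :=
        le_trans (mul_le_mul_of_nonneg_left hlogn (mul_nonneg hfact.le hP0)) hle
      have h2 : (∏ p ∈ n.primeFactors, Real.log (p : ℝ)) ≤
          2 / ((((s - 1).factorial : ℕ) : ℝ) * L) * (generalizedVonMangoldt 2 * Λ ^ (s - 1)) n := by
        rw [div_mul_eq_mul_div, le_div_iff₀ (by positivity)]
        nlinarith
      calc A.a n * ((∏ p ∈ n.primeFactors, Real.log (p : ℝ)) / L ^ s)
          ≤ A.a n * ((2 / ((((s - 1).factorial : ℕ) : ℝ) * L) *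
              (generalizedVonMangoldt 2 * Λ ^ (s - 1)) n) / L ^ s) :=
            mul_le_mul_of_nonneg_left (div_le_div_of_nonneg_right h2 (pow_nonneg hL.le _)) (A.a_nonneg n)
        _ = _ := by rw [pow_succ]; field_simp
    calc _ ≤ ∑ n ∈ (Ps s x).filter (fun n : ℕ => ¬ (n : ℝ) ≤ Real.sqrt x),
          2 / ((((s - 1).factorial : ℕ) : ℝ) * L ^ (s + 1)) *
            ((generalizedVonMangoldt 2 * Λ ^ (s - 1)) n * A.a n) := Finset.sum_le_sum hpt
      _ ≤ ∑ n ∈ Ioc 0 N, 2 / ((((s - 1).factorial : ℕ) : ℝ) * L ^ (s + 1)) *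
            ((generalizedVonMangoldt 2 * Λ ^ (s - 1)) n * A.a n) := by
          refine Finset.sum_le_sum_of_subset_of_nonneg (fun n hn => ?_) fun n _ _ =>
            mul_nonneg (by positivity) (mul_nonneg ?_ (A.a_nonneg n))
          · have hn' := (Finset.mem_filter.mp hn).1
            obtain ⟨⟨hn1, hnN⟩, -, -⟩ := mem_Ps.mp hn'
            exact Finset.mem_Ioc.mpr ⟨hn1, hnN⟩
          · rw [ArithmeticFunction.mul_apply]
            exact Finset.sum_nonneg fun y _ => mul_nonneg (generalizedVonMangoldt_nonneg 2 _)
              (pow_vonMangoldt_nonneg (s - 1) _)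
      _ = 2 / ((((s - 1).factorial : ℕ) : ℝ) * L ^ (s + 1)) *
            ∑ n ∈ Ioc 0 N, (generalizedVonMangoldt 2 * Λ ^ (s - 1)) n * A.a n := by rw [Finset.mul_sum]
      _ ≤ 2 / ((((s - 1).factorial : ℕ) : ℝ) * L ^ (s + 1)) * (2 * (γ * H * A.size x * L ^ s)) :=
          mul_le_mul_of_nonneg_left hTx (by positivity)
      _ = C₁ * A.size x / L := by
          rw [hC₁, pow_succ]
          field_simp
          ring
  calc _ ≤ A.size x / L + C₁ * A.size x / L := add_le_add hsmall hlarge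
    _ = (C₁ + 1) * A.size x / L := by ring

end BombieriPr

end Analytic



end Literature.NumberTheory.Sieve

end
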